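import Literature.NumberTheory.PAdicHodge.CompletedAlgClosureBaseChange
import Literature.NumberTheory.GaloisRepresentations.LocalFieldPadicProofs
import Mathlib.NumberTheory.Padics.Complex
import Mathlib.Analysis.AbsoluteValue.Equivalence
import Mathlib.Analysis.SpecialFunctions.Pow.Continuity
import HarnessLib

/-!
# X11b · S29 K3 (T4): the transport `ℂ_{ℚ_p} ≅ ℂ_[p]` between the tree's completed algebraic closure
# of the local field `ℚ_[p]` and Mathlib's `PadicComplex` (every prime `p`; theorems only)

HONEST FRAMING (cell `b2b-bsdres`, run/shared/lean/b2b/bsd-rank1-residual/, verbatim in every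
file): the goal of the cell is to DELETE the COMBINATION-SHAPED residual classes of the
Birch–Swinnerton-Dyer formula for ALL analytic-rank `≤ 1` elliptic curves over `ℚ` — assembled
STRICTLY from published theorems — so that the rank-`≤ 1` remainder becomes exactly the
CONSTRUCTION-SHAPED classes, which are TYPED, NOT attempted. This is not "finishing BSD". Team
`x11b3` = N8/O2 (X11b at `p = 3`): research routes; nothing booked; no label change; O2 OPEN; the
node of record `Three.HsiehDescentAt₃` is UNCHANGED by this file (sub-target S29 RE-EXPRESSES (t)
⟸ (VR); lead GEN 8 R9-8 / R9-21 / R9-25).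

PROVENANCE: S29 kernel package K3 = [T2 T3 T4 T5] (x11b3-p7's `K4-PLAN.md`, r2's (T′), lead R9-25),
item (T4) 'transport', seat `b2b-bsdres-x11b3-p1` GEN 3 (`HOME/b2b-bsdres-x11b3-p1/gen3/K3-INVENTORY.md`).
The p-adic Hodge theory of the tree (Tate's theorem `TateTwistInvariants`, Ax–Sen–Tate
`AxSenTateRelative`, Lang `UnramifiedPeriodMatrix`, the embedding `maxUnramifiedCompletion.toC`) lives
on `ℂ_F = PAdicHodge.CompletedAlgClosure F`, the completion of the synonym
`NormedAlgClosure F := AlgebraicClosure F` for the VALUATION norm of the local field `F`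
(`IsNonarchimedeanLocalField.nontriviallyNormedField F`, a non-canonical rank-one choice), whereas
the node `Three.HsiehDescentAt₃` speaks Mathlib's `PadicAlgCl p ⊂ ℂ_[p] ⊃ PadicComplexInt p ⊃
unrIntegers p`. For `F = ℚ_[p]` (a local field by the tree THEOREM
`Padic.isNonarchimedeanLocalField_holds`, supplied by consumers through the instance binder
`[IsNonarchimedeanLocalField ℚ_[p]]`) the two completions are canonically isomorphic; this file
proves it, with the norm law and the compatibilities a consumer needs. NO definition is introduced:
the isomorphism is delivered as an `∃` with a characterising property and a uniqueness theorem.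

## What is proved

* §1 `exists_algNorm_algebraMap_eq_norm_rpow` — on `ℚ_[p]` the tree's valuation norm (written
  `algNorm ℚ_[p] ∘ algebraMap`, so that no second norm instance on `ℚ_[p]` is named) is a positive
  power `‖x‖ ^ c` of Mathlib's `p`-adic norm (both are absolute values defining the topology of
  `ℚ_[p]`; Mathlib `AbsoluteValue.isEquiv_of_lt_one_imp`, `isEquiv_iff_exists_rpow_eq`).
* §2 `exists_algNorm_eq_norm_rpow` — on `ℚ̄_p = AlgebraicClosure ℚ_[p]` the tree's `algNorm ℚ_[p]`
  is the same power of Mathlib's spectral norm of `PadicAlgCl p` (uniqueness of the extension of a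
  complete absolute value, Mathlib `spectralNorm_unique_field_norm_ext`),
  `exists_norm_normedAlgClosure_eq_norm_rpow`; `continuous_algEquiv` — `ℚ_[p]`-automorphisms of
  `PadicAlgCl p` are continuous (isometries) for Mathlib's norm.
* §3 **`exists_ringEquiv_padicComplex`** — there are `c > 0` and a ring isomorphism
  `e : CompletedAlgClosure ℚ_[p] ≃+* ℂ_[p]` extending the identity of `ℚ̄_p`
  (`e ↑x = ↑(toAlgClosure x)`), with `‖e z‖ = ‖z‖ ^ c`, `e` and `e⁻¹` uniformly continuous
  (Mathlib `UniformSpace.Completion.mapRingEquiv`; pattern of the tree's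
  `CompletedAlgClosureBaseChange.exists_completedAlgClosure_ringEquiv`).
* §5 `exists_continuous_ringHom_padicComplex_extending`, `ringHom_padicComplex_ext` — each
  `σ ∈ Γ_{ℚ_p}` acts on `ℂ_[p]` by the unique continuous ring endomorphism `T_σ = e ∘ σ ∘ e⁻¹`
  extending `σ` on `ℚ̄_p` (the currency of x11b3-p7's K4 interfaces).
* §4 consumer lemmas for ANY continuous `e` extending the identity: uniqueness
  (`ringEquiv_padicComplex_unique`), the Galois compatibility on `ℚ̄_p`
  (`ringEquiv_padicComplex_smul_coe`), `e ∘ algebraMap`, and the unit-ball / unit-sphere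
  transfer under a norm law `‖e z‖ = ‖z‖ ^ c`.

References: [NeukirchANT1999] Ch. II (3.3), (4.8); [FontaineOuyang2022] §3.1 (`C = \widehat{K̄}`).
Mathlib: `NumberTheory/Padics/Complex` (`PadicAlgCl`, `PadicComplex`), `Analysis/AbsoluteValue/Equivalence`,
`Analysis/Normed/Unbundled/SpectralNorm`.
-/

noncomputable section

open Field ValuativeRel UniformSpace Filter
open scoped Topology

namespace Summit.BirchSwinnertonDyer.Rank1Residual.X11b.PadicComplexTransport

open Literature.NumberTheory.PAdicHodge
open Literature.NumberTheory.GaloisRepresentations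
open Literature.NumberTheory.GaloisRepresentations.IsNonarchimedeanLocalField

variable {p : ℕ} [Fact p.Prime] [IsNonarchimedeanLocalField ℚ_[p]]

/-! ### §1 The two absolute values of `ℚ_[p]` -/

variable (p) in
/-- **The valuation norm of the local field `ℚ_[p]` is a positive power of the `p`-adic norm.**
The tree's absolute value of `ℚ_[p]` is `x ↦ algNorm ℚ_[p] (algebraMap x)` (the spectral norm
`algNorm` restricted along `ℚ_[p] → ℚ̄_p` IS the valuation norm
`IsNonarchimedeanLocalField.nontriviallyNormedField ℚ_[p]`, tree `algNorm_algebraMap`; we use this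
explicit function so that no second norm instance on `ℚ_[p]` is ever named); there is a real `c > 0`
with `algNorm ℚ_[p] (algebraMap x) = ‖x‖ ^ c` for all `x`, `‖·‖` Mathlib's norm. Proof:
`‖x‖ < 1 ⇒ v(x) < 1` (Mathlib's `Padic.mulValuation` and the valuative relation it defines) `⇒` the
valuation norm of `x` is `< 1`; for two absolute values this forces equivalence, i.e. one is a
positive power of the other (Neukirch II (3.3); Mathlib `AbsoluteValue.isEquiv_of_lt_one_imp`,
`isEquiv_iff_exists_rpow_eq`). [cite: NeukirchANT1999, Ch. II (3.3)] -/
theorem exists_algNorm_algebraMap_eq_norm_rpow :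
    ∃ c : ℝ, 0 < c ∧ ∀ x : ℚ_[p],
      algNorm ℚ_[p] (algebraMap ℚ_[p] (PadicAlgCl p) x) = ‖x‖ ^ c := by
  -- Mathlib's norm as an absolute value, nontrivial at `p`
  have hv : (NormedField.toAbsoluteValue ℚ_[p]).IsNontrivial :=
    ⟨p, Nat.cast_ne_zero.2 (Fact.out : p.Prime).ne_zero, (Padic.norm_p_lt_one (p := p)).ne⟩
  -- the valuation norm as an absolute value, through `algNorm ∘ algebraMap`
  obtain ⟨w, hw⟩ : ∃ w : AbsoluteValue ℚ_[p] ℝ, ∀ x,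
      w x = algNorm ℚ_[p] (algebraMap ℚ_[p] (PadicAlgCl p) x) :=
    ⟨{ toFun := fun x => algNorm ℚ_[p] (algebraMap ℚ_[p] (PadicAlgCl p) x),
        map_mul' := fun x y => by simp only [map_mul, algNorm_mul],
        nonneg' := fun x => algNorm_nonneg _,
        eq_zero' := fun x => by
          show algNorm ℚ_[p] (algebraMap ℚ_[p] (PadicAlgCl p) x) = 0 ↔ x = 0
          rw [algNorm_eq_zero_iff, map_eq_zero],
        add_le' := fun x y => by
          show algNorm ℚ_[p] (algebraMap ℚ_[p] (PadicAlgCl p) (x + y)) ≤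
            algNorm ℚ_[p] (algebraMap ℚ_[p] (PadicAlgCl p) x) +
              algNorm ℚ_[p] (algebraMap ℚ_[p] (PadicAlgCl p) y)
          rw [map_add]
          exact (algNorm_add_le _ _).trans
            (max_le (le_add_of_nonneg_right (algNorm_nonneg _))
              (le_add_of_nonneg_left (algNorm_nonneg _))) },
      fun _ => rfl⟩
  -- `‖x‖ < 1 ⇒ w x < 1`
  have hlt : ∀ x : ℚ_[p], NormedField.toAbsoluteValue ℚ_[p] x < 1 → w x < 1 := by
    intro x hx
    change ‖x‖ < 1 at hx
    have h1 : _root_.Padic.mulValuation x < 1 := by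
      have h := Padic.norm_lt_norm_iff_mulValuation_lt p x 1
      rw [norm_one, map_one] at h
      exact h.1 hx
    have h2 : valuation ℚ_[p] x < 1 :=
      ((ValuativeRel.isEquiv (valuation ℚ_[p]) (_root_.Padic.mulValuation (p := p))).lt_one_iff_lt_one).2 h1
    rw [hw, algNorm_algebraMap]
    exact (IsNonarchimedeanLocalField.norm_lt_one_iff ℚ_[p] x).2 h2
  obtain ⟨c, hc, hcw⟩ := AbsoluteValue.isEquiv_iff_exists_rpow_eq.1
    (AbsoluteValue.isEquiv_of_lt_one_imp hv hlt)
  refine ⟨c, hc, fun x => ?_⟩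
  rw [← hw x]
  exact ((congrFun hcw x).symm : w x = NormedField.toAbsoluteValue ℚ_[p] x ^ c)

/-! ### §2 The two absolute values of `ℚ̄_p` -/

variable (p) in
/-- **`algNorm ℚ_[p] = ‖·‖ ^ c` on `ℚ̄_p`**: the tree's spectral extension `algNorm ℚ_[p]` of the
valuation norm and Mathlib's spectral norm of `PadicAlgCl p` differ by the exponent `c` of §1 on ALL
of `ℚ̄_p`: the absolute value `y ↦ (algNorm ℚ_[p] y)^{1/c}` of `ℚ̄_p` extends Mathlib's norm of the
complete field `ℚ_[p]`, hence is its spectral norm (Neukirch II (4.8), uniqueness; Mathlib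
`spectralNorm_unique_field_norm_ext`). [cite: NeukirchANT1999, Ch. II (4.8)] -/
theorem exists_algNorm_eq_norm_rpow :
    ∃ c : ℝ, 0 < c ∧ ∀ y : PadicAlgCl p, algNorm ℚ_[p] y = ‖y‖ ^ c := by
  obtain ⟨c, hc, hcx⟩ := exists_algNorm_algebraMap_eq_norm_rpow p
  refine ⟨c, hc, fun y => ?_⟩
  -- the absolute value `y ↦ algNorm y ^ (1/c)` of `ℚ̄_p`
  obtain ⟨f, hf⟩ : ∃ f : AbsoluteValue (PadicAlgCl p) ℝ, ∀ y, f y = algNorm ℚ_[p] y ^ c⁻¹ :=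
    ⟨{ toFun := fun y => algNorm ℚ_[p] y ^ c⁻¹,
        map_mul' := fun y z => by
          simp only [algNorm_mul]
          exact Real.mul_rpow (algNorm_nonneg _) (algNorm_nonneg _),
        nonneg' := fun y => Real.rpow_nonneg (algNorm_nonneg _) _,
        eq_zero' := fun y => by
          show algNorm ℚ_[p] y ^ c⁻¹ = 0 ↔ y = 0
          rw [Real.rpow_eq_zero_iff_of_nonneg (algNorm_nonneg _), algNorm_eq_zero_iff]
          exact and_iff_left (inv_ne_zero hc.ne'),
        add_le' := fun y z => by
          show algNorm ℚ_[p] (y + z) ^ c⁻¹ ≤ algNorm ℚ_[p] y ^ c⁻¹ + algNorm ℚ_[p] z ^ c⁻¹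
          rcases le_total (algNorm ℚ_[p] y) (algNorm ℚ_[p] z) with h | h
          · exact (Real.rpow_le_rpow (algNorm_nonneg _)
                ((algNorm_add_le _ _).trans (max_le h le_rfl)) (inv_nonneg.2 hc.le)).trans
              (le_add_of_nonneg_left (Real.rpow_nonneg (algNorm_nonneg _) _))
          · exact (Real.rpow_le_rpow (algNorm_nonneg _)
                ((algNorm_add_le _ _).trans (max_le le_rfl h)) (inv_nonneg.2 hc.le)).trans
              (le_add_of_nonneg_right (Real.rpow_nonneg (algNorm_nonneg _) _)) },
      fun _ => rfl⟩
  -- `f` extends Mathlib's norm of `ℚ_[p]`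
  have hf_ext : ∀ k : ℚ_[p], f (algebraMap ℚ_[p] (PadicAlgCl p) k) = ‖k‖ := by
    intro k
    rw [hf, hcx k, Real.rpow_rpow_inv (norm_nonneg _) hc.ne']
  -- uniqueness of the extension of the complete absolute value of `ℚ_[p]`
  have hfy : f y = ‖y‖ := by
    rw [← PadicAlgCl.spectralNorm_eq]
    exact spectralNorm_unique_field_norm_ext hf_ext y
  rw [hf] at hfy
  rw [← hfy, Real.rpow_inv_rpow (algNorm_nonneg _) hc.ne']

/-- The norm of the synonym `NormedAlgClosure ℚ_[p]` (tree) versus Mathlib's norm of `PadicAlgCl p`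
on the same element: `‖x‖ = ‖toAlgClosure x‖ ^ c` with the exponent of §2.
[cite: NeukirchANT1999, Ch. II (4.8)] -/
theorem exists_norm_normedAlgClosure_eq_norm_rpow :
    ∃ c : ℝ, 0 < c ∧ ∀ x : NormedAlgClosure ℚ_[p],
      ‖x‖ = ‖(NormedAlgClosure.toAlgClosure x : PadicAlgCl p)‖ ^ c := by
  obtain ⟨c, hc, hcy⟩ := exists_algNorm_eq_norm_rpow p
  exact ⟨c, hc, fun x => by rw [NormedAlgClosure.norm_def, hcy]⟩

omit [IsNonarchimedeanLocalField ℚ_[p]] in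
/-- Every `ℚ_[p]`-algebra automorphism `σ` of `ℚ̄_p` is continuous for Mathlib's norm — indeed an
isometry, `‖σ y‖ = ‖y‖`, since the norm of `PadicAlgCl p` is the `Aut`-invariant spectral norm
(Mathlib `spectralNorm_eq_of_equiv`; the isometry statement itself is already in the tree as
`Literature.NumberTheory.LFunctions.Dwork.norm_algEquiv_apply` and is not restated here). This is the
hypothesis `Continuous τ` of `X11b/Three/RangeGaloisTransport` for Galois `τ`. [folklore] -/
theorem continuous_algEquiv (σ : PadicAlgCl p ≃ₐ[ℚ_[p]] PadicAlgCl p) : Continuous σ := by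
  refine (AddMonoidHomClass.isometry_of_norm σ fun y => ?_).continuous
  rw [← PadicAlgCl.spectralNorm_eq, ← PadicAlgCl.spectralNorm_eq]
  exact (spectralNorm_eq_of_equiv σ y).symm

/-! ### §3 The isomorphism `ℂ_{ℚ_p} ≅ ℂ_[p]` -/

variable (p) in
/-- **`ℂ_{ℚ_p} ≅ ℂ_[p]`.** There are a real `c > 0` and a ring isomorphism
`e : CompletedAlgClosure ℚ_[p] ≃+* ℂ_[p]` from the tree's completed algebraic closure of the
local field `ℚ_[p]` onto Mathlib's `PadicComplex p` such that: `e` extends the identity of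
`ℚ̄_p` (`e ↑x = ↑(toAlgClosure x)` for `x : NormedAlgClosure ℚ_[p]`, `toAlgClosure` the identity
`NormedAlgClosure ℚ_[p] ≃ₐ AlgebraicClosure ℚ_[p] = PadicAlgCl p`); `‖e z‖ = ‖z‖ ^ c`; `e` and
`e.symm` are uniformly continuous. Proof: by §2 the identity `ℚ̄_p → ℚ̄_p` between the two normed
structures multiplies norms in the exponent (`‖x‖_val = ‖x‖ ^ c′`, so `‖x‖ = ‖x‖_val ^ {1/c′}`), hence
it and its inverse are uniformly continuous and extend to the completions (Fontaine–Ouyang §3.1: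
`C` is functorial in the valued field `K̄`). [cite: FontaineOuyang2022, §3.1] -/
theorem exists_ringEquiv_padicComplex :
    ∃ (c : ℝ) (_ : 0 < c) (e : CompletedAlgClosure ℚ_[p] ≃+* ℂ_[p]),
      (∀ x : NormedAlgClosure ℚ_[p],
          e (x : CompletedAlgClosure ℚ_[p]) =
            ((NormedAlgClosure.toAlgClosure x : PadicAlgCl p) : ℂ_[p])) ∧
      (∀ z : CompletedAlgClosure ℚ_[p], ‖e z‖ = ‖z‖ ^ c) ∧
      UniformContinuous e ∧ UniformContinuous e.symm := by
  obtain ⟨c, hc, hcy⟩ := exists_norm_normedAlgClosure_eq_norm_rpow (p := p)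
  -- Step 1: the identity as a ring isomorphism of the two normed copies of `ℚ̄_p`
  obtain ⟨ι, hι⟩ : ∃ ι : NormedAlgClosure ℚ_[p] ≃+* PadicAlgCl p,
      ∀ x, ι x = NormedAlgClosure.toAlgClosure x :=
    ⟨(NormedAlgClosure.toAlgClosure (F := ℚ_[p])).toRingEquiv, fun _ => rfl⟩
  -- norm laws of `ι` and `ι⁻¹`
  have hι_norm : ∀ x, ‖ι x‖ = ‖x‖ ^ c⁻¹ := fun x => by
    rw [hι, hcy, Real.rpow_rpow_inv (norm_nonneg _) hc.ne']
  have hιs_norm : ∀ y, ‖ι.symm y‖ = ‖y‖ ^ c := fun y => by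
    have h := hι_norm (ι.symm y)
    rw [RingEquiv.apply_symm_apply] at h
    rw [← Real.rpow_inv_rpow (norm_nonneg (ι.symm y)) hc.ne', ← h]
  -- Step 2: uniform continuity of `ι`, `ι⁻¹` and the extension to the completions
  have hιu : UniformContinuous ι := uniformContinuous_of_norm_map_eq_rpow ι (inv_pos.2 hc) hι_norm
  have hιsu : UniformContinuous ι.symm := uniformContinuous_of_norm_map_eq_rpow ι.symm hc hιs_norm
  obtain ⟨e, he⟩ : ∃ e : CompletedAlgClosure ℚ_[p] ≃+* ℂ_[p], ∀ x, e x = Completion.map ι x :=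
    ⟨Completion.mapRingEquiv ι hιu.continuous hιsu.continuous, Completion.mapRingEquiv_apply ι _ _⟩
  have he_coe : ∀ a : NormedAlgClosure ℚ_[p],
      e (a : CompletedAlgClosure ℚ_[p]) = ((NormedAlgClosure.toAlgClosure a : PadicAlgCl p) : ℂ_[p]) :=
    fun a => by rw [he, Completion.map_coe hιu, hι]
  have he_cont : Continuous e := Completion.continuous_map.congr fun x => (he x).symm
  -- Step 3: the norm law on `ℂ_{ℚ_p}` by density of `ℚ̄_p`; uniform continuity from the norm law
  have he_norm : ∀ z : CompletedAlgClosure ℚ_[p], ‖e z‖ = ‖z‖ ^ c⁻¹ := fun z => by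
    refine Completion.induction_on z
      (isClosed_eq (continuous_norm.comp he_cont)
        (continuous_norm.rpow_const fun _ => Or.inr (inv_pos.2 hc).le)) fun a => ?_
    rw [he_coe, PadicComplex.norm_extends, Completion.norm_coe, ← hι, hι_norm]
  have hes_norm : ∀ y : ℂ_[p], ‖e.symm y‖ = ‖y‖ ^ c := fun y => by
    have h := he_norm (e.symm y)
    rw [RingEquiv.apply_symm_apply] at h
    rw [← Real.rpow_inv_rpow (norm_nonneg (e.symm y)) hc.ne', ← h]
  exact ⟨c⁻¹, inv_pos.2 hc, e, he_coe, he_norm,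
    uniformContinuous_of_norm_map_eq_rpow e (inv_pos.2 hc) he_norm,
    uniformContinuous_of_norm_map_eq_rpow e.symm hc hes_norm⟩

/-! ### §4 Consumer lemmas for any continuous `e` extending the identity -/

/-- **Uniqueness**: two continuous maps `ℂ_{ℚ_p} → ℂ_[p]` extending the identity of `ℚ̄_p` agree
(`ℚ̄_p` is dense in `ℂ_{ℚ_p}`). [folklore] -/
theorem ringEquiv_padicComplex_unique {e e' : CompletedAlgClosure ℚ_[p] → ℂ_[p]}
    (he : Continuous e) (he' : Continuous e')
    (h : ∀ x : NormedAlgClosure ℚ_[p],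
      e (x : CompletedAlgClosure ℚ_[p]) = ((NormedAlgClosure.toAlgClosure x : PadicAlgCl p) : ℂ_[p]))
    (h' : ∀ x : NormedAlgClosure ℚ_[p],
      e' (x : CompletedAlgClosure ℚ_[p]) = ((NormedAlgClosure.toAlgClosure x : PadicAlgCl p) : ℂ_[p])) :
    e = e' :=
  funext fun z => Completion.induction_on z (isClosed_eq he he') fun a => by rw [h, h']

/-- **Galois compatibility on `ℚ̄_p`**: an `e` extending the identity carries the action of
`σ ∈ Γ_{ℚ_p}` on `ℚ̄_p ⊂ ℂ_{ℚ_p}` to the tautological action of the `ℚ_[p]`-algebra automorphism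
`absoluteGaloisGroup.toAlgEquiv ℚ_[p] σ` of `PadicAlgCl p`. [folklore] -/
theorem ringEquiv_padicComplex_smul_coe {e : CompletedAlgClosure ℚ_[p] → ℂ_[p]}
    (h : ∀ x : NormedAlgClosure ℚ_[p],
      e (x : CompletedAlgClosure ℚ_[p]) = ((NormedAlgClosure.toAlgClosure x : PadicAlgCl p) : ℂ_[p]))
    (σ : absoluteGaloisGroup ℚ_[p]) (x : NormedAlgClosure ℚ_[p]) :
    e (σ • (x : CompletedAlgClosure ℚ_[p])) =
      ((absoluteGaloisGroup.toAlgEquiv ℚ_[p] σ (NormedAlgClosure.toAlgClosure x) : PadicAlgCl p) :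
        ℂ_[p]) := by
  rw [CompletedAlgClosure.smul_coe, h, NormedAlgClosure.smul_eq_toAlgEquiv]

/-- An `e` extending the identity of `ℚ̄_p` is compatible with the structure maps from `ℚ_[p]`:
`e (algebraMap ℚ_[p] ℂ_{ℚ_p} k) = (k : ℂ_[p])`. [folklore] -/
theorem ringEquiv_padicComplex_algebraMap {e : CompletedAlgClosure ℚ_[p] → ℂ_[p]}
    (h : ∀ x : NormedAlgClosure ℚ_[p],
      e (x : CompletedAlgClosure ℚ_[p]) = ((NormedAlgClosure.toAlgClosure x : PadicAlgCl p) : ℂ_[p]))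
    (k : ℚ_[p]) :
    e (algebraMap ℚ_[p] (CompletedAlgClosure ℚ_[p]) k) = ((k : PadicAlgCl p) : ℂ_[p]) := by
  rw [CompletedAlgClosure.algebraMap_eq_coe, h]
  rfl

/-- Under a norm law `‖e z‖ = ‖z‖ ^ c` with `c > 0`: `‖e z‖ ≤ 1 ↔ ‖z‖ ≤ 1` (unit balls
correspond). [folklore] -/
theorem norm_map_le_one_iff {e : CompletedAlgClosure ℚ_[p] → ℂ_[p]} {c : ℝ} (hc : 0 < c)
    (he : ∀ z, ‖e z‖ = ‖z‖ ^ c) (z : CompletedAlgClosure ℚ_[p]) : ‖e z‖ ≤ 1 ↔ ‖z‖ ≤ 1 := by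
  rw [he]
  simpa only [Real.one_rpow] using Real.rpow_le_rpow_iff (norm_nonneg z) zero_le_one hc

/-- Under a norm law `‖e z‖ = ‖z‖ ^ c` with `c > 0`: `‖e z‖ < 1 ↔ ‖z‖ < 1`. [folklore] -/
theorem norm_map_lt_one_iff {e : CompletedAlgClosure ℚ_[p] → ℂ_[p]} {c : ℝ} (hc : 0 < c)
    (he : ∀ z, ‖e z‖ = ‖z‖ ^ c) (z : CompletedAlgClosure ℚ_[p]) : ‖e z‖ < 1 ↔ ‖z‖ < 1 := by
  rw [he]
  simpa only [Real.one_rpow] using Real.rpow_lt_rpow_iff (norm_nonneg z) zero_le_one hc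

/-- Under a norm law `‖e z‖ = ‖z‖ ^ c` with `c > 0`: `‖e z‖ = 1 ↔ ‖z‖ = 1` (unit spheres
correspond; with `unrIntegers.isUnit_iff_norm_eq_one` this transports units of `R₀`). [folklore] -/
theorem norm_map_eq_one_iff {e : CompletedAlgClosure ℚ_[p] → ℂ_[p]} {c : ℝ} (hc : 0 < c)
    (he : ∀ z, ‖e z‖ = ‖z‖ ^ c) (z : CompletedAlgClosure ℚ_[p]) : ‖e z‖ = 1 ↔ ‖z‖ = 1 := by
  refine ⟨fun h => ?_, fun h => by rw [he, h, Real.one_rpow]⟩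
  have h1 : ‖z‖ ≤ 1 := (norm_map_le_one_iff hc he z).1 h.le
  have h2 : ¬ ‖z‖ < 1 := fun hlt => (ne_of_lt ((norm_map_lt_one_iff hc he z).2 hlt)) h
  exact le_antisymm h1 (not_lt.1 h2)

/-! ### §5 The transported Galois action on `ℂ_[p]` as continuous extensions -/

/-- **`σ ∈ Γ_{ℚ_p}` acts on `ℂ_[p]` by a continuous ring endomorphism extending `σ` on `ℚ̄_p`.**
For a bi-continuous `e : ℂ_{ℚ_p} ≃+* ℂ_[p]` extending the identity of `ℚ̄_p` (§3) and
`σ ∈ Γ_{ℚ_p}`, the conjugate `T_σ = e ∘ (σ • ·) ∘ e⁻¹` is a continuous ring homomorphism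
`ℂ_[p] →+* ℂ_[p]` with `T_σ y = σ y` on `y ∈ ℚ̄_p = PadicAlgCl p` (`σ` as the `ℚ_[p]`-algebra
automorphism `absoluteGaloisGroup.toAlgEquiv ℚ_[p] σ`, the identity identification) and
`T_σ (e z) = e (σ • z)`. This is the currency `(T : ℂ_[3] →+* ℂ_[3]) (hT : Continuous T)
(hTτ : ∀ x, T x = τ x)` of S29 K4 (x11b3-p7 `K4-INTERFACES.md`). [cite: FontaineOuyang2022, §3.1] -/
theorem exists_continuous_ringHom_padicComplex_extending (e : CompletedAlgClosure ℚ_[p] ≃+* ℂ_[p])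
    (he : Continuous e) (hes : Continuous e.symm)
    (h : ∀ x : NormedAlgClosure ℚ_[p],
      e (x : CompletedAlgClosure ℚ_[p]) = ((NormedAlgClosure.toAlgClosure x : PadicAlgCl p) : ℂ_[p]))
    (σ : absoluteGaloisGroup ℚ_[p]) :
    ∃ T : ℂ_[p] →+* ℂ_[p], Continuous T ∧
      (∀ y : PadicAlgCl p, T (y : ℂ_[p]) = ((absoluteGaloisGroup.toAlgEquiv ℚ_[p] σ y : PadicAlgCl p) : ℂ_[p])) ∧
      ∀ z : CompletedAlgClosure ℚ_[p], T (e z) = e (σ • z) := by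
  refine ⟨e.toRingHom.comp ((CompletedAlgClosure.galRingHom σ).comp e.symm.toRingHom),
    he.comp ((CompletedAlgClosure.continuous_galRingHom σ).comp hes), fun y => ?_, fun z => ?_⟩
  · -- on `ℚ̄_p`: `e⁻¹ ↑y = ↑x` with `x = toAlgClosure⁻¹ y`, then `σ • ↑x = ↑(σ • x)`
    set x : NormedAlgClosure ℚ_[p] := NormedAlgClosure.toAlgClosure.symm y with hx
    have hy : (y : ℂ_[p]) = e (x : CompletedAlgClosure ℚ_[p]) := by
      rw [h, hx, AlgEquiv.apply_symm_apply]
    change e (CompletedAlgClosure.galRingHom σ (e.symm (y : ℂ_[p]))) = _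
    rw [hy, RingEquiv.symm_apply_apply, ← CompletedAlgClosure.smul_def,
      CompletedAlgClosure.smul_coe, h, NormedAlgClosure.smul_eq_toAlgEquiv, hx,
      AlgEquiv.apply_symm_apply]
  · change e (CompletedAlgClosure.galRingHom σ (e.symm (e z))) = e (σ • z)
    rw [RingEquiv.symm_apply_apply, CompletedAlgClosure.smul_def]

omit [IsNonarchimedeanLocalField ℚ_[p]] in
/-- **Continuous ring endomorphisms of `ℂ_[p]` are determined on `ℚ̄_p`** (density of
`PadicAlgCl p` in its completion): the `T` of `exists_continuous_ringHom_padicComplex_extending` is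
the unique continuous extension of `σ`. [folklore] -/
theorem ringHom_padicComplex_ext {T T' : ℂ_[p] →+* ℂ_[p]} (hT : Continuous T) (hT' : Continuous T')
    (h : ∀ y : PadicAlgCl p, T (y : ℂ_[p]) = T' (y : ℂ_[p])) : T = T' :=
  RingHom.ext fun z => Completion.induction_on z (isClosed_eq hT hT') h

end Summit.BirchSwinnertonDyer.Rank1Residual.X11b.PadicComplexTransport

end
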